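import Mathlib
import HarnessLib
import Summits.NavierStokesRegularity.NavierStokesRegularity.Theorems.PoloidalWindowDoorPoloidalWindowRigidityStructureFunction

/-!
# Route `PoloidalWindowDoor`, crux `PoloidalWindowRigidity` (K2, stmt-NavierStokesRegularity-19708) —
# THE CLEBSCH SLOPE IS THE `q`-DERIVATIVE OF THE STRUCTURE FUNCTION: `∇_h v₂ = F_q ∇_h ψ`, `∂₂v₂ = F_q ∂₂ψ + F_z`

Cell ns-regularity-ideate, seat ns-poloidal-K2-p3 gen 5 (stub-worker; file landed `--supports stmt-NavierStokesRegularity-19708`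
as a helper).  Sequel to `…StructureFunction` (this seat, p531376: near every vortical point of a poloidal profile of the
class, `v₂ = F(t, ψ, x₂)` with `F` of class `Cⁿ`).  Differentiating that identity along the slices identifies the tree's
CLEBSCH SLOPE `Λ` (`∇_h v₂ = Λ ∇_h ψ`; nsreg-p7 / K2 lead, `…SlopeLaw`, `…EllipticSlope*`) with `F_q(t, ψ, x₂)` and gives
the vertical derivative `∂₂v₂ = F_q ∂₂ψ + F_z` — the two first-order identities from which K2P1-LOCAL-NOTES §1(e) writes
T0 (`Δφ + ∂₂ψ = 0` in `q`-coordinates) and Dyn.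

* `hasFDerivAt_slice_of_eq_structureFunction`, `fderiv_slice_eq_of_eq_structureFunction` — generic scalar form: if
  `f t y = F (t, g t y, y₂)` near `(t₀, y₀)` (`uncurry g` differentiable near and continuous at the point, `F` of class `Cⁿ`
  there), then near `(t₀, y₀)` the slice `f t` is differentiable with `D(f t)(y) e = F_q · D(g t)(y) e + e₂ · F_z` (partials
  of `F` at `(t, g t y, y₂)`) — serves `v₂ = F(t,ψ,x₂)` AND the `q`-coordinates `ψ = A(t, q, x₂)` alike;
* `fderiv_apply_two_eq_of_structureFunction` — the same for the vertical velocity: `(D(v t) y e)₂ = F_q · D(ψ t)(y) e + e₂ · F_z`;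
* `exists_structureFunction_slope` — CLASS: profile of the route's Type-I class, poloidal along `e₃`, `ψ` a `Cⁿ` function
  carrying the vorticity, `ω(t₀, y₀) ≠ 0` ⇒ a structure function with BOTH the identity and its differentiated form.

WHAT THIS IS NOT: not a claim about Navier–Stokes regularity, not LRC″, not T0/Dyn — the first-order identities of the
normal form (bears_on LADDER-NS N0 via crux K2 = stmt-19708).
-/

noncomputable section

-- the summit and its single sub-problem share the name (CONVENTIONS §1), as in every Theorems file
set_option linter.dupNamespace false

namespace Summit.NavierStokesRegularity.NavierStokesRegularity.Theorems.PoloidalWindowDoorPoloidalWindowRigidityStructureFunctionSlope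

open Set Function Filter Topology Metric
open scoped RealInnerProductSpace InnerProductSpace Laplacian ContDiff
open Literature.Analysis Literature.Analysis.FluidPDE
open Summit.NavierStokesRegularity.NavierStokesRegularity.Theorems.LocalSineTubeDoorProfileAlignedWindowRigidityAncient
open Summit.NavierStokesRegularity.NavierStokesRegularity.Theorems.PoloidalWindowDoorPoloidalWindowRigidityStructureFunction

variable {C : ℝ} {v : ℝ → EuclideanSpace ℝ (Fin 3) → EuclideanSpace ℝ (Fin 3)}

/-! ### Differentiating the structure-function identity: `∂_e v₂ = F_q ∂_e ψ + e₂ F_z` -/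

/-- **Differentiating a structure-function identity `f = F(t, g, x₂)` along the slices (scalar form).**  If
`f t y = F (t, g t y, y₂)` for all `(t, y)` near `(t₀, y₀)`, with `uncurry g` differentiable near `(t₀, y₀)` and continuous
there, and `F` of class `Cⁿ` (`n ≠ 0`) at `(t₀, g t₀ y₀, (y₀)₂)`, then for all `(t, y)` near `(t₀, y₀)` the slice `f t` has at
`y` the derivative `e ↦ F_q · D(g t)(y) e + e₂ · F_z` (partials of `F` at `(t, g t y, y₂)`: `F_q = DF(0,1,0)`, `F_z = DF(0,0,1)`). -/
theorem hasFDerivAt_slice_of_eq_structureFunction {n : WithTop ℕ∞} (hn : n ≠ 0)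
    {f g : ℝ → EuclideanSpace ℝ (Fin 3) → ℝ} {F : ℝ × ℝ × ℝ → ℝ} {t₀ : ℝ} {y₀ : EuclideanSpace ℝ (Fin 3)}
    (hg : ∀ᶠ z in 𝓝 (t₀, y₀), DifferentiableAt ℝ (uncurry g) z)
    (hF : ContDiffAt ℝ n F (t₀, g t₀ y₀, y₀ 2))
    (hcontg : ContinuousAt (uncurry g) (t₀, y₀))
    (heq : ∀ᶠ z in 𝓝 (t₀, y₀), f z.1 z.2 = F (z.1, g z.1 z.2, z.2 2)) :
    ∀ᶠ z in 𝓝 (t₀, y₀), HasFDerivAt (f z.1)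
      ((fderiv ℝ F (z.1, g z.1 z.2, z.2 2) ((0 : ℝ), (1 : ℝ), (0 : ℝ))) • fderiv ℝ (g z.1) z.2 +
        (fderiv ℝ F (z.1, g z.1 z.2, z.2 2) ((0 : ℝ), (0 : ℝ), (1 : ℝ))) •
          (EuclideanSpace.proj (2 : Fin 3) : EuclideanSpace ℝ (Fin 3) →L[ℝ] ℝ)) z.2 := by
  have hn1 : (1 : WithTop ℕ∞) ≤ n := ENat.one_le_iff_ne_zero_withTop.mpr hn
  have hF1 : ∀ᶠ p in 𝓝 (t₀, g t₀ y₀, y₀ 2), DifferentiableAt ℝ F p :=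
    ((hF.of_le hn1).eventually (by simp)).mono fun p hp => hp.differentiableAt one_ne_zero
  have hT : Tendsto (fun z : ℝ × EuclideanSpace ℝ (Fin 3) => (z.1, g z.1 z.2, z.2 2)) (𝓝 (t₀, y₀))
      (𝓝 (t₀, g t₀ y₀, y₀ 2)) := by
    have h1 : ContinuousAt (fun z : ℝ × EuclideanSpace ℝ (Fin 3) => z.1) (t₀, y₀) := continuousAt_fst
    have h3 : ContinuousAt (fun z : ℝ × EuclideanSpace ℝ (Fin 3) => z.2 2) (t₀, y₀) :=
      ((EuclideanSpace.proj (2 : Fin 3) : EuclideanSpace ℝ (Fin 3) →L[ℝ] ℝ).continuous.continuousAt).comp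
        continuousAt_snd
    exact (h1.prodMk (hcontg.prodMk h3)).tendsto
  filter_upwards [hg.eventually_nhds, heq.eventually_nhds, hT.eventually hF1] with z hgz heqz hFz
  obtain ⟨t, y⟩ := z
  have hι : Tendsto (fun y' : EuclideanSpace ℝ (Fin 3) => (t, y')) (𝓝 y) (𝓝 (t, y)) :=
    (continuousAt_const.prodMk continuousAt_id).tendsto
  have heqy : ∀ᶠ y' in 𝓝 y, f t y' = F (t, g t y', y' 2) := hι.eventually heqz
  have hgy : DifferentiableAt ℝ (g t) y := by
    have h := (hgz.self_of_nhds : DifferentiableAt ℝ (uncurry g) (t, y))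
    exact h.comp y ((differentiableAt_const _).prodMk differentiableAt_id)
  have hγ : HasFDerivAt (fun y' : EuclideanSpace ℝ (Fin 3) => (t, g t y', y' 2))
      ((0 : EuclideanSpace ℝ (Fin 3) →L[ℝ] ℝ).prod ((fderiv ℝ (g t) y).prod
        (EuclideanSpace.proj (2 : Fin 3) : EuclideanSpace ℝ (Fin 3) →L[ℝ] ℝ))) y := by
    refine (hasFDerivAt_const t y).prodMk (hgy.hasFDerivAt.prodMk ?_)
    exact (EuclideanSpace.proj (2 : Fin 3) : EuclideanSpace ℝ (Fin 3) →L[ℝ] ℝ).hasFDerivAt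
  have hcomp : HasFDerivAt (fun y' : EuclideanSpace ℝ (Fin 3) => F (t, g t y', y' 2))
      ((fderiv ℝ F (t, g t y, y 2)).comp ((0 : EuclideanSpace ℝ (Fin 3) →L[ℝ] ℝ).prod ((fderiv ℝ (g t) y).prod
        (EuclideanSpace.proj (2 : Fin 3) : EuclideanSpace ℝ (Fin 3) →L[ℝ] ℝ)))) y :=
    (hFz : DifferentiableAt ℝ F (t, g t y, y 2)).hasFDerivAt.comp y hγ
  have hf : HasFDerivAt (f t)
      ((fderiv ℝ F (t, g t y, y 2)).comp ((0 : EuclideanSpace ℝ (Fin 3) →L[ℝ] ℝ).prod ((fderiv ℝ (g t) y).prod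
        (EuclideanSpace.proj (2 : Fin 3) : EuclideanSpace ℝ (Fin 3) →L[ℝ] ℝ)))) y :=
    hcomp.congr_of_eventuallyEq (heqy.mono fun y' hy' => by simpa using hy')
  refine hf.congr_fderiv ?_
  ext e
  simp only [ContinuousLinearMap.comp_apply, ContinuousLinearMap.prod_apply, zero_apply, add_apply,
    smul_apply, smul_eq_mul]
  have hdec : ((0 : ℝ), fderiv ℝ (g t) y e, (EuclideanSpace.proj (2 : Fin 3) : EuclideanSpace ℝ (Fin 3) →L[ℝ] ℝ) e) =
      (fderiv ℝ (g t) y e) • ((0 : ℝ), (1 : ℝ), (0 : ℝ)) + (e 2) • ((0 : ℝ), (0 : ℝ), (1 : ℝ)) := by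
    ext <;> simp
  rw [hdec, map_add, map_smul, map_smul, smul_eq_mul, smul_eq_mul]
  have hp : (EuclideanSpace.proj (2 : Fin 3) : EuclideanSpace ℝ (Fin 3) →L[ℝ] ℝ) e = e 2 := rfl
  rw [hp]
  ring

/-- The same in `fderiv` form: near `(t₀, y₀)`, for every direction `e`,
`D(f t)(y) e = F_q(t, g t y, y₂) · D(g t)(y) e + e₂ · F_z(t, g t y, y₂)`. -/
theorem fderiv_slice_eq_of_eq_structureFunction {n : WithTop ℕ∞} (hn : n ≠ 0)
    {f g : ℝ → EuclideanSpace ℝ (Fin 3) → ℝ} {F : ℝ × ℝ × ℝ → ℝ} {t₀ : ℝ} {y₀ : EuclideanSpace ℝ (Fin 3)}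
    (hg : ∀ᶠ z in 𝓝 (t₀, y₀), DifferentiableAt ℝ (uncurry g) z)
    (hF : ContDiffAt ℝ n F (t₀, g t₀ y₀, y₀ 2))
    (hcontg : ContinuousAt (uncurry g) (t₀, y₀))
    (heq : ∀ᶠ z in 𝓝 (t₀, y₀), f z.1 z.2 = F (z.1, g z.1 z.2, z.2 2)) :
    ∀ᶠ z in 𝓝 (t₀, y₀), ∀ e : EuclideanSpace ℝ (Fin 3),
      fderiv ℝ (f z.1) z.2 e =
        fderiv ℝ F (z.1, g z.1 z.2, z.2 2) ((0 : ℝ), (1 : ℝ), (0 : ℝ)) * fderiv ℝ (g z.1) z.2 e +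
          e 2 * fderiv ℝ F (z.1, g z.1 z.2, z.2 2) ((0 : ℝ), (0 : ℝ), (1 : ℝ)) := by
  filter_upwards [hasFDerivAt_slice_of_eq_structureFunction hn hg hF hcontg heq] with z hz e
  rw [hz.fderiv]
  have hp : (EuclideanSpace.proj (2 : Fin 3) : EuclideanSpace ℝ (Fin 3) →L[ℝ] ℝ) e = e 2 := rfl
  simp only [add_apply, smul_apply, smul_eq_mul, hp]
  ring

/-- **The slice derivatives of `v₂ = F(t, ψ, x₂)`.**  Suppose `v t y 2 = F (t, ψ t y, y₂)` for all `(t, y)` near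
`(t₀, y₀)`, with `uncurry ψ` differentiable near `(t₀, y₀)` and `F` of class `Cⁿ` (`n ≠ 0`) at `(t₀, ψ t₀ y₀, (y₀)₂)`.
Then for all `(t, y)` near `(t₀, y₀)` and every direction `e`:
`D(v t)(y) e · e₂… = (D(v₂ t))(y) e = ∂_qF · D(ψ t)(y) e + e₂ · ∂_zF`, the partials of `F` taken at `(t, ψ t y, y₂)`
(`∂_qF = DF(·)(0,1,0)`, `∂_zF = DF(·)(0,0,1)`).  In particular the horizontal gradients are proportional,
`∇_h v₂ = F_q(t, ψ, x₂) ∇_h ψ`: the Clebsch slope `Λ` of the tree (`∇_h v₂ = Λ ∇_h ψ`, `…SlopeLaw`) is `F_q` along the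
flow, and `∂₂v₂ = F_q ∂₂ψ + F_z`. -/
theorem fderiv_apply_two_eq_of_structureFunction {n : WithTop ℕ∞} (hn : n ≠ 0)
    {ψ : ℝ → EuclideanSpace ℝ (Fin 3) → ℝ} {F : ℝ × ℝ × ℝ → ℝ} {t₀ : ℝ} {y₀ : EuclideanSpace ℝ (Fin 3)}
    (hv : ∀ᶠ z in 𝓝 (t₀, y₀), DifferentiableAt ℝ (v z.1) z.2)
    (hψ : ∀ᶠ z in 𝓝 (t₀, y₀), DifferentiableAt ℝ (uncurry ψ) z)
    (hF : ContDiffAt ℝ n F (t₀, ψ t₀ y₀, y₀ 2))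
    (hcontψ : ContinuousAt (uncurry ψ) (t₀, y₀))
    (heq : ∀ᶠ z in 𝓝 (t₀, y₀), v z.1 z.2 2 = F (z.1, ψ z.1 z.2, z.2 2)) :
    ∀ᶠ z in 𝓝 (t₀, y₀), ∀ e : EuclideanSpace ℝ (Fin 3),
      fderiv ℝ (v z.1) z.2 e 2 =
        fderiv ℝ F (z.1, ψ z.1 z.2, z.2 2) ((0 : ℝ), (1 : ℝ), (0 : ℝ)) * fderiv ℝ (ψ z.1) z.2 e +
          e 2 * fderiv ℝ F (z.1, ψ z.1 z.2, z.2 2) ((0 : ℝ), (0 : ℝ), (1 : ℝ)) := by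
  have h := hasFDerivAt_slice_of_eq_structureFunction (f := fun t y => v t y 2) hn hψ hF hcontψ heq
  filter_upwards [h, hv] with z hz hvz e
  -- `y ↦ v t y 2 = proj₂ (v t y)`: its derivative is `proj₂ ∘ D(v t)`
  have hproj : HasFDerivAt (fun y' : EuclideanSpace ℝ (Fin 3) => v z.1 y' 2)
      ((EuclideanSpace.proj (2 : Fin 3) : EuclideanSpace ℝ (Fin 3) →L[ℝ] ℝ).comp (fderiv ℝ (v z.1) z.2)) z.2 :=
    (EuclideanSpace.proj (2 : Fin 3) : EuclideanSpace ℝ (Fin 3) →L[ℝ] ℝ).hasFDerivAt.comp z.2 hvz.hasFDerivAt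
  have huniq := congrArg (fun L : EuclideanSpace ℝ (Fin 3) →L[ℝ] ℝ => L e) (hz.unique hproj)
  have hp : (EuclideanSpace.proj (2 : Fin 3) : EuclideanSpace ℝ (Fin 3) →L[ℝ] ℝ) e = e 2 := rfl
  have h2 : ((EuclideanSpace.proj (2 : Fin 3) : EuclideanSpace ℝ (Fin 3) →L[ℝ] ℝ).comp (fderiv ℝ (v z.1) z.2)) e =
      fderiv ℝ (v z.1) z.2 e 2 := rfl
  simp only [add_apply, smul_apply, smul_eq_mul, hp, h2] at huniq
  rw [← huniq]
  ring

/-- **The Clebsch slope is the `q`-derivative of the structure function (class form).**  For a profile of the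
route's Type-I class, poloidal along `e₃`, any `Cⁿ` space–time `ψ` carrying the vorticity as `ω = (∂₁ψ, −∂₀ψ, 0)`,
and a vortical point `(t₀, y₀)` of the slab: there is a structure function `F`, `Cⁿ` at `(t₀, ψ t₀ y₀, (y₀)₂)`, with
`v₂ = F(t, ψ, x₂)` near `(t₀, y₀)` AND, for all `(t, y)` near `(t₀, y₀)` and every direction `e`,
`(D(v t) y e)₂ = F_q(t, ψ t y, y₂) · D(ψ t)(y) e + e₂ · F_z(t, ψ t y, y₂)` — in particular `∇_h v₂ = F_q ∇_h ψ`
(the tree's Clebsch slope `Λ`, `∇_h v₂ = Λ ∇_h ψ`, equals `F_q` along the flow) and `∂₂v₂ = F_q ∂₂ψ + F_z`. -/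
theorem exists_structureFunction_slope {n : WithTop ℕ∞} (hn : n ≠ 0)
    (hrate : HasTypeITimeDecay C v)
    (hcont : ContinuousOn (uncurry v) (Iio (0 : ℝ) ×ˢ univ))
    (hmild : ∀ s t : ℝ, s < t → t < 0 → ∀ x,
      v t x = UnboundedOperators.heatExtension (v s) (t - s) x - oseenDuhamel 1 s v v t x)
    (hdiv : ∀ t < 0, VectorCalculus.IsDivFree (v t))
    (hpol : ∀ s < 0, ∀ y, ⟪curl (v s) y, EuclideanSpace.single 2 1⟫_ℝ = 0)
    {ψ : ℝ → EuclideanSpace ℝ (Fin 3) → ℝ} {t₀ : ℝ} {y₀ : EuclideanSpace ℝ (Fin 3)} (ht₀ : t₀ < 0)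
    (hψ : ContDiffAt ℝ n (uncurry ψ) (t₀, y₀))
    (hω : ∀ t < 0, ∀ y, curl (v t) y 0 = fderiv ℝ (ψ t) y (EuclideanSpace.single 1 1) ∧
      curl (v t) y 1 = -fderiv ℝ (ψ t) y (EuclideanSpace.single 0 1))
    (hne : curl (v t₀) y₀ ≠ 0) :
    ∃ F : ℝ × ℝ × ℝ → ℝ, ContDiffAt ℝ n F (t₀, ψ t₀ y₀, y₀ 2) ∧
      (∀ᶠ z in 𝓝 (t₀, y₀), v z.1 z.2 2 = F (z.1, ψ z.1 z.2, z.2 2)) ∧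
      ∀ᶠ z in 𝓝 (t₀, y₀), ∀ e : EuclideanSpace ℝ (Fin 3),
        fderiv ℝ (v z.1) z.2 e 2 =
          fderiv ℝ F (z.1, ψ z.1 z.2, z.2 2) ((0 : ℝ), (1 : ℝ), (0 : ℝ)) * fderiv ℝ (ψ z.1) z.2 e +
            e 2 * fderiv ℝ F (z.1, ψ z.1 z.2, z.2 2) ((0 : ℝ), (0 : ℝ), (1 : ℝ)) := by
  have hn1 : (1 : WithTop ℕ∞) ≤ n := ENat.one_le_iff_ne_zero_withTop.mpr hn
  obtain ⟨F, hFc, hFeq⟩ :=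
    exists_verticalVelocity_eq_structureFunction hn hrate hcont hmild hdiv hpol ht₀ hψ hω hne
  refine ⟨F, hFc, hFeq, ?_⟩
  have hmem : (t₀, y₀) ∈ Iio (0 : ℝ) ×ˢ (univ : Set (EuclideanSpace ℝ (Fin 3))) :=
    mem_prod.2 ⟨show t₀ < 0 from ht₀, mem_univ _⟩
  have hslab : Iio (0 : ℝ) ×ˢ (univ : Set (EuclideanSpace ℝ (Fin 3))) ∈ 𝓝 (t₀, y₀) :=
    (isOpen_Iio.prod isOpen_univ).mem_nhds hmem
  have hv : ∀ᶠ z in 𝓝 (t₀, y₀), DifferentiableAt ℝ (v z.1) z.2 := by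
    filter_upwards [hslab] with z hz
    exact (analyticOnNhd_slice hcont (bdd_of_hasTypeITimeDecay hrate) hmild (mem_prod.1 hz).1 z.2
      (mem_univ _)).differentiableAt
  have hψd : ∀ᶠ z in 𝓝 (t₀, y₀), DifferentiableAt ℝ (uncurry ψ) z :=
    ((hψ.of_le hn1).eventually (by simp)).mono fun z hz => hz.differentiableAt one_ne_zero
  exact fderiv_apply_two_eq_of_structureFunction hn hv hψd hFc hψ.continuousAt hFeq

end Summit.NavierStokesRegularity.NavierStokesRegularity.Theorems.PoloidalWindowDoorPoloidalWindowRigidityStructureFunctionSlope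

end
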